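import Summits.CriticalPhenomena.SAWScalingLimit.Theorems.SAWLeftRightFKGFKGToTraversalBoundSlitNecklaceFarTipU
import Summits.CriticalPhenomena.SAWScalingLimit.Theorems.SAWLeftRightFKGFKGToTraversalBoundSlitNecklaceOutline
import HarnessLib

/-!
# Vocabulary of line `slit-necklace`, part 8: the data of ONE far-tip configuration (witness glue)

Crux `SAWLeftRightFKG.FKGToTraversalBound` (stmt-CriticalPhenomena-1878), line `slit-necklace`, lead
prover-line-stmt-CriticalPhenomena-1878-c5-0; NOTES `## Witness plan v2`.

`NecklaceWitnessFarU` (…SlitNecklaceFarTipU.lean) quantifies, inside `∀ᶠ δ`, over a presentation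
`(c, C, S, Ka, Kb, a₀, b₀, ca, cb, ιa, ιb, η, γ)` of the domain with ten hypotheses, and then over a far-tip piece
`(i, j, τ, τ')`.  The glue proves it through a dozen ≤ 400-line lemmas; to keep their statements readable this file
bundles that data into ONE structure `FarTipCfg D` (fields = exactly those binders and hypotheses, plus `0 < δ` and
`τ < τ'`, the non-trivial case) and names the derived objects every lemma speaks about: the spine `Sp = Ka ∪ Kb ∪ S`,
the exterior `Ext` of the middle (vertices of `γ` of index `< τ` or `> τ'`), the attached set `K = Sp ∪ Ext`, the tips
`t₀ = γ τ`, `t₁ = γ τ'`, the lattice domain `Λ`, the free set `Fset` (sites joined to `t₀` in the carrier graph off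
`K`), the carrier component `Bset` of `t₀`, the far-piece count `nfar`, and the cost `Kc W nB`.  Small closed API
(membership unfoldings).  Definitions only; no literature fact; nothing restates the crux.
-/

noncomputable section

open Filter Topology Set Metric
open Literature.Probability.LatticeModels
open Literature.Probability.RandomPlanarGeometry
open Literature.Probability.RandomPlanarGeometry.SAW
open Summit.CriticalPhenomena.SAWScalingLimit.Theorems.FKGToTraversalBound.Negative (dom)

namespace Summit.CriticalPhenomena.SAWScalingLimit.Theorems.FKGToTraversalBound.SlitNecklace

/-- **One presented configuration** of the planar witness: a mesh `δ > 0`, a presentation `(C, S)` of the domain `D`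
with the identity `hid` and attached spine `Ka ∪ Kb ∪ S` (`hatt`), a self-avoiding chord `γ` of `D_δ` from `a₀ ∈ Ka` to
`b₀ ∈ Kb`, and the blob/centre/reach parameters with their three inequalities — verbatim the binders and hypotheses of
`NecklaceWitnessFarU` between `∀ᶠ δ` and `∃ rk` (the rank must be a function of this data alone). [folklore] -/
structure PresCfg (D : DobrushinDomain) where
  /-- mesh -/
  δ : ℝ
  /-- positive mesh -/
  hδ : 0 < δ
  /-- base point of the presenting walk -/
  c : Site 2
  /-- the closed lattice walk presenting the carrier `dom C δ` -/
  C : (zdGraph 2).Walk c c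
  /-- defect set -/
  S : Finset (Site 2)
  /-- blob at the first marked point -/
  Ka : Finset (Site 2)
  /-- blob at the second marked point -/
  Kb : Finset (Site 2)
  /-- start of the chord -/
  a₀ : Site 2
  /-- end of the chord -/
  b₀ : Site 2
  /-- first marked centre -/
  ca : ℂ
  /-- second marked centre -/
  cb : ℂ
  /-- radius of the first blob -/
  ιa : ℝ
  /-- radius of the second blob -/
  ιb : ℝ
  /-- the reach (far = at distance `≥ η` from both centres) -/
  η : ℝ
  /-- the chord -/
  γ : (discreteDomainGraph D.carrier δ).Walk a₀ b₀
  /-- presentation identity: the carrier graph is the domain graph off the defects -/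
  hid : ∀ x' y' : Site 2, (discreteDomainGraph (dom C δ) δ).Adj x' y' ↔
    ((discreteDomainGraph D.carrier δ).Adj x' y' ∧ x' ∉ S ∧ y' ∉ S)
  /-- the spine is attached to the trace of `C` -/
  hatt : ∀ k ∈ Ka ∪ Kb ∪ S, ∃ (q : Site 2) (w : (zdGraph 2).Walk k q), q ∈ C.support ∧
    ∀ z ∈ w.support, z ∈ Ka ∪ Kb ∪ S ∨ z ∈ C.support
  /-- the chord is self-avoiding -/
  hγ : γ.IsPath
  /-- the chord starts in the first blob -/
  ha₀ : a₀ ∈ Ka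
  /-- the chord ends in the second blob -/
  hb₀ : b₀ ∈ Kb
  /-- first blob within `ιa` of its centre -/
  hKa : ∀ k ∈ Ka, dist (meshPoint δ k) ca ≤ ιa
  /-- second blob within `ιb` of its centre -/
  hKb : ∀ k ∈ Kb, dist (meshPoint δ k) cb ≤ ιb
  /-- reach versus first blob -/
  hιa : ιa + 3 * δ ≤ η
  /-- reach versus second blob -/
  hιb : ιb + 3 * δ ≤ η
  /-- the centres are far apart -/
  hab : 2 * η + δ < dist ca cb

/-- **One far-tip configuration**: a presented configuration together with a far-tip piece `(i, j; τ, τ')` of its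
chord with `τ < τ'` (the non-trivial case of the witness). [folklore] -/
structure FarTipCfg (D : DobrushinDomain) extends PresCfg D where
  /-- start index of the piece -/
  i : ℕ
  /-- end index of the piece -/
  j : ℕ
  /-- first far index -/
  τ : ℕ
  /-- last far index -/
  τ' : ℕ
  /-- `(i, j; τ, τ')` is a far-tip piece of `γ` off the spine -/
  hft : IsFarTipPiece (meshPoint δ) γ (↑(Ka ∪ Kb ∪ S)) i j τ τ' ca cb η
  /-- the non-trivial case: the middle has at least one edge -/
  hττ' : τ < τ'

namespace PresCfg

variable {D : DobrushinDomain} (cfg : PresCfg D)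

/-- The spine `Ka ∪ Kb ∪ S`. [folklore] -/
def Sp : Finset (Site 2) := cfg.Ka ∪ cfg.Kb ∪ cfg.S

/-- The carrier graph `(dom C δ)_δ`. [folklore] -/
abbrev G : SimpleGraph (Site 2) := discreteDomainGraph (dom cfg.C cfg.δ) cfg.δ

/-- The domain graph `D_δ`. [folklore] -/
abbrev Dg : SimpleGraph (Site 2) := discreteDomainGraph D.carrier cfg.δ

/-- The lattice domain `Λ = meshDomain (dom C δ) δ`. [folklore] -/
def Λ : Set (Site 2) := meshDomain (dom cfg.C cfg.δ) cfg.δ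

/-- The set of start indices of the FAR PIECES of the configuration. [folklore] -/
def farStarts : Set ℕ :=
  {i' | ∃ j', IsFarPiece (meshPoint cfg.δ) cfg.γ (↑cfg.Sp) (↑cfg.S) i' j' cfg.ca cfg.cb cfg.η}

/-- The number of far pieces. [folklore] -/
def nfar : ℕ := cfg.farStarts.ncard

/-- The COST of the witness: `8 (nfar + #S + 2)² (W + nB + 2)`. [folklore] -/
def Kc (W nB : ℕ) : ℕ := 8 * (cfg.nfar + cfg.S.card + 2) ^ 2 * (W + nB + 2)

/-- The INTERIOR vertex set of the piece `(i', j')`: vertices of `γ` of index strictly between. [folklore] -/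
def V (i' j' : ℕ) : Set (Site 2) := {z | ∃ m, i' < m ∧ m < j' ∧ cfg.γ.getVert m = z}

/-- The end index of the piece starting at `i'` (junk `0` if `i'` starts no piece). [folklore] -/
def pend (i' : ℕ) : ℕ := by
  classical
  exact if h : ∃ j', IsPiece cfg.γ (↑cfg.Sp) i' j' then Nat.find h else 0

/-- NON-DEGENERATE piece start: the piece has at least two interior vertices (`i' + 3 ≤ j'`). [folklore] -/
def NonDeg (i' : ℕ) : Prop := i' + 3 ≤ cfg.pend i'

/-- The free territory `U = Λ ∖ Sp` in which ranks are measured. [folklore] -/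
def U : Set (Site 2) := cfg.Λ \ ↑cfg.Sp

/-- The `U`-component of a site: sites joined to it by a lattice walk inside `U`. [folklore] -/
def compU (z : Site 2) : Set (Site 2) := {x | ∃ w : (zdGraph 2).Walk x z, ∀ v ∈ w.support, v ∈ cfg.U}

/-- A ROOT of the `U`-component of `z` (a fixed choice; `z` itself if the component is empty, i.e. `z ∉ U`).
[folklore] -/
def rootAt (z : Site 2) : Site 2 := by
  classical
  exact if h : (cfg.compU z).Nonempty then h.some else z

/-- The DESCENDANTS of the far piece starting at `i'`: the other non-degenerate far pieces of the same `U`-component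
all of whose `U`-walks to the root meet the interior of the piece `i'` ("separated from the root by it").
[folklore] -/
def desc (i' : ℕ) : Finset ℕ := by
  classical
  exact (Finset.range (cfg.γ.length + 1)).filter fun i'' =>
    i'' ≠ i' ∧ i'' ∈ cfg.farStarts ∧ cfg.NonDeg i'' ∧
      cfg.γ.getVert (i'' + 1) ∈ cfg.compU (cfg.γ.getVert (i' + 1)) ∧
      ∀ x ∈ cfg.V i'' (cfg.pend i''), ∀ w : (zdGraph 2).Walk x (cfg.rootAt (cfg.γ.getVert (i' + 1))),
        (∀ v ∈ w.support, v ∈ cfg.U) → ∃ v ∈ w.support, v ∈ cfg.V i' (cfg.pend i')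

/-- The RANK of the far piece starting at `i'`: its number of descendants. [folklore] -/
def rk (i' : ℕ) : ℕ := (cfg.desc i').card

/-- `Sp` unfolded. [folklore] -/
@[simp] theorem Sp_def : cfg.Sp = cfg.Ka ∪ cfg.Kb ∪ cfg.S := rfl

/-- Membership in `V`. [folklore] -/
theorem mem_V_iff {i' j' : ℕ} {z : Site 2} : z ∈ cfg.V i' j' ↔ ∃ m, i' < m ∧ m < j' ∧ cfg.γ.getVert m = z := Iff.rfl

end PresCfg

/-- **Registered glue**: the rank is at most the number of far pieces (every far start is `≤ |γ|`, so `desc i'`,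
a subset of the far starts, injects into the finite set `farStarts`). [folklore] -/
theorem rk_le_nfar : ∀ {D : DobrushinDomain} (cfg : PresCfg D) (i' : ℕ), (∀ i'' ∈ cfg.farStarts, i'' ≤ cfg.γ.length) → cfg.rk i' ≤ cfg.nfar := by
  intro D cfg i' hfs
  classical
  have hfin : cfg.farStarts.Finite :=
    (Finset.range (cfg.γ.length + 1)).finite_toSet.subset fun x hx => by
      simp only [Finset.coe_range, Set.mem_Iio]
      exact Nat.lt_succ_of_le (hfs x hx)
  unfold PresCfg.rk PresCfg.nfar
  rw [Set.ncard_eq_toFinset_card _ hfin]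
  refine Finset.card_le_card fun x hx => ?_
  unfold PresCfg.desc at hx
  simp only [Finset.mem_filter] at hx
  exact hfin.mem_toFinset.2 hx.2.2.1


namespace FarTipCfg

variable {D : DobrushinDomain} (cfg : FarTipCfg D)

/-- The EXTERIOR of the middle: vertices of `γ` of index `< τ` or `> τ'` (stubs of the piece, the rest of the chord).
[folklore] -/
def Ext : Finset (Site 2) :=
  ((Finset.range (cfg.γ.length + 1)).filter (fun m => m < cfg.τ ∨ cfg.τ' < m)).image cfg.γ.getVert

/-- The ATTACHED set `K = Sp ∪ Ext` that the route must avoid. [folklore] -/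
def K : Finset (Site 2) := cfg.Sp ∪ cfg.Ext

/-- The first far tip `t₀ = γ τ`. [folklore] -/
def t₀ : Site 2 := cfg.γ.getVert cfg.τ

/-- The last far tip `t₁ = γ τ'`. [folklore] -/
def t₁ : Site 2 := cfg.γ.getVert cfg.τ'

/-- The FREE SET: sites joined to the first tip by a carrier walk avoiding `K`. [folklore] -/
def Fset : Set (Site 2) := {x | ∃ q : cfg.G.Walk x cfg.t₀, ∀ v ∈ q.support, v ∉ cfg.K}

/-- The carrier COMPONENT of the first tip: sites joined to it by a carrier walk. [folklore] -/
def Bset : Set (Site 2) := {x | Nonempty (cfg.G.Walk x cfg.t₀)}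

/-- `K` unfolded. [folklore] -/
@[simp] theorem K_def : cfg.K = cfg.Sp ∪ cfg.Ext := rfl

/-- Membership in `Ext`. [folklore] -/
theorem mem_Ext_iff {z : Site 2} :
    z ∈ cfg.Ext ↔ ∃ m, m ≤ cfg.γ.length ∧ (m < cfg.τ ∨ cfg.τ' < m) ∧ cfg.γ.getVert m = z := by
  simp only [Ext, Finset.mem_image, Finset.mem_filter, Finset.mem_range]
  constructor
  · rintro ⟨m, ⟨hm, h⟩, rfl⟩
    exact ⟨m, by omega, h, rfl⟩
  · rintro ⟨m, hm, h, rfl⟩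
    exact ⟨m, ⟨by omega, h⟩, rfl⟩

/-- Membership in `Fset`. [folklore] -/
theorem mem_Fset_iff {x : Site 2} : x ∈ cfg.Fset ↔ ∃ q : cfg.G.Walk x cfg.t₀, ∀ v ∈ q.support, v ∉ cfg.K :=
  Iff.rfl

/-- Membership in `Bset`. [folklore] -/
theorem mem_Bset_iff {x : Site 2} : x ∈ cfg.Bset ↔ Nonempty (cfg.G.Walk x cfg.t₀) := Iff.rfl

/-- The free set lies in the carrier component. [folklore] -/
theorem Fset_subset_Bset : cfg.Fset ⊆ cfg.Bset := fun _ ⟨q, _⟩ => ⟨q⟩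

/-- Basic index facts of the far-tip piece: `i < τ < τ' < j ≤ |γ|`. [folklore] -/
theorem idx_facts : cfg.i < cfg.τ ∧ cfg.τ < cfg.τ' ∧ cfg.τ' < cfg.j ∧ cfg.j ≤ cfg.γ.length :=
  ⟨cfg.hft.2.1, cfg.hττ', cfg.hft.2.2.2.1, cfg.hft.1.2.1.1⟩

end FarTipCfg

end Summit.CriticalPhenomena.SAWScalingLimit.Theorems.FKGToTraversalBound.SlitNecklace

end
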